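import Summits.QuantumFields.YangMills.Theorems.LuscherReductionOneSiteLevelsKacPotentialTransfer
import Summits.QuantumFields.YangMills.Theorems.LuscherReductionOneSiteLevelsKacColourRotate
import Literature.Analysis.UnboundedOperators.HeatKernelReversePoincare

/-!
# INNER, flat lane (layer III): the heat-smoothed remainder — admissibility, energy, almost-orthogonality

Support module of crux `OneSiteLevels` (route `LuscherReduction`, item stmt-QuantumFields-20007), FLAT lane of the
registered v12 stub `stub_flatKacAL1` (STUB-PLAN rev 3 rows H6d, H6b = III.2, H6e).

For a bounded measurable integrable colour-invariant `r` (with `(1 + ‖x‖⁴) r² ∈ L¹` where the potential is involved)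
and `u = P_s r = heatSmooth s r`:

* H6d `isKacFn_heatSmooth`: `u ∈ IsKacFn` — smooth (`contDiff_heatSmooth`), invariant (`isGaugeInv_heatSmooth`), `u, ∂u, ∂²u`
  bounded (maximum principle and the toolkit's sup-norm gradient estimate, twice through the semigroup law), `u ∈ L¹`,
  `∂u ∈ L²` (`memLp_fderiv_heatExtension_apply`), `V u² ∈ L¹` (the potential transfer).
* H6b `half_integral_norm_gradient_sq_heatSmooth_le_flatJump`: `½ ∫ ‖∇ P_{t/2} r‖² ≤ flatJump t r` — the Bakry–Émery
  reverse Poincaré inequality of the toolkit (`sq_heatExtension_add_le_heatExtension_sq`) integrated in space, through the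
  semigroup split `P_{t/2} = e^{σΔ} e^{(t/4−σ)Δ}` and `σ ↑ t/4` (sharp constant `½`; no Fourier analysis, no heat equation).
* H6e `abs_integral_heatSmooth_mul_le`: for `r ⊥ f`, `|⟨P_s r, f⟩| ≤ ‖r‖₂ · √((s/2) ∫‖Df‖²)` (transposition + Ledoux defect +
  Cauchy–Schwarz `abs_integral_mul_le_sqrt_mul_sqrt`).

Real analysis only ([folklore]); NOT the stub; femto rung R2b1; NOT a claim about the gap.
References: D. Bakry, I. Gentil, M. Ledoux (2014) Thm. 4.7.2; M. Ledoux, Math. Res. Lett. 10 (2003) §1.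
-/

set_option autoImplicit false

noncomputable section

open MeasureTheory Filter Topology Real
open Literature.Analysis.OperatorTheory.YMMatrixModel

namespace Summit.QuantumFields.YangMills.Theorems.FemtoTransferGap

/-! ### §0. Small tools -/

/-- `‖∇u(x)‖ = ‖Du(x)‖` (Riesz). [folklore] -/
theorem norm_gradient_eq_norm_fderiv (u : ZM → ℝ) (x : ZM) : ‖gradient u x‖ = ‖fderiv ℝ u x‖ := by
  rw [gradient, LinearIsometryEquiv.norm_map]

/-- `‖e_p‖ = 1`. [folklore] -/
theorem norm_unitDir (p : Fin 3 × Fin 3) : ‖unitDir p‖ = 1 := by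
  rw [unitDir]
  have h := PiLp.norm_single 2 (fun _ : Fin 3 × Fin 3 => ℝ) p (1 : ℝ)
  rw [norm_one] at h
  exact h

/-- `|∂_p u (x)| ≤ ‖Du(x)‖`. [folklore] -/
theorem abs_pderiv_le_norm_fderiv (u : ZM → ℝ) (p : Fin 3 × Fin 3) (x : ZM) : |pderiv p u x| ≤ ‖fderiv ℝ u x‖ := by
  rw [pderiv, ← Real.norm_eq_abs]
  refine (ContinuousLinearMap.le_opNorm _ _).trans ?_
  rw [norm_unitDir, mul_one]

/-- **Cauchy–Schwarz for `∫ a b`** on `L²` data: `|∫ a b| ≤ √(∫a²) · √(∫b²)`. [folklore] -/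
theorem abs_integral_mul_le_sqrt_mul_sqrt {a b : ZM → ℝ} (ha : MemLp a 2 volume) (hb : MemLp b 2 volume) :
    |∫ x, a x * b x| ≤ Real.sqrt (∫ x, a x ^ 2) * Real.sqrt (∫ x, b x ^ 2) := by
  have ha2 : Integrable fun x => a x ^ 2 := ha.integrable_sq
  have hb2 : Integrable fun x => b x ^ 2 := hb.integrable_sq
  have hab : Integrable fun x => a x * b x := ha.integrable_mul hb
  set A := ∫ x, a x ^ 2 with hA
  set B := ∫ x, b x ^ 2 with hB
  have hA0 : 0 ≤ A := integral_nonneg fun x => sq_nonneg _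
  have hB0 : 0 ≤ B := integral_nonneg fun x => sq_nonneg _
  -- `2λ |∫ab| ≤ λ² A + B` for every real `λ`
  have key : ∀ l : ℝ, 2 * l * |∫ x, a x * b x| ≤ l ^ 2 * A + B := by
    intro l
    have h1 : |∫ x, a x * b x| ≤ ∫ x, |a x * b x| := by
      simpa only [Real.norm_eq_abs] using norm_integral_le_integral_norm (fun x => a x * b x)
    have h2 : ∫ x, 2 * |l| * |a x * b x| ≤ ∫ x, (l ^ 2 * a x ^ 2 + b x ^ 2) := by
      refine integral_mono ((hab.abs.const_mul _)) ((ha2.const_mul _).add hb2) fun x => ?_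
      have := sq_nonneg (|l| * |a x| - |b x|)
      rw [abs_mul]
      nlinarith [sq_abs l, sq_abs (a x), sq_abs (b x), abs_nonneg l, abs_nonneg (a x), abs_nonneg (b x)]
    rw [integral_const_mul, integral_add (ha2.const_mul _) hb2, integral_const_mul] at h2
    have h3 : 2 * l * |∫ x, a x * b x| ≤ 2 * |l| * |∫ x, a x * b x| := by
      nlinarith [le_abs_self l, abs_nonneg (∫ x, a x * b x)]
    nlinarith [mul_le_mul_of_nonneg_left h1 (by positivity : (0:ℝ) ≤ 2 * |l|)]
  rcases hA0.eq_or_lt with hA00 | hApos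
  · -- `A = 0`: then `|∫ab| ≤ B/(2λ)` for all `λ > 0`, so `∫ab = 0`
    have h0 : |∫ x, a x * b x| ≤ 0 := by
      by_contra hne
      push Not at hne
      have hl := key ((B + 1) / |∫ x, a x * b x|)
      rw [← hA00, mul_zero, zero_add] at hl
      have : 2 * ((B + 1) / |∫ x, a x * b x|) * |∫ x, a x * b x| = 2 * (B + 1) := by
        field_simp
      linarith
    have : |∫ x, a x * b x| = 0 := le_antisymm h0 (abs_nonneg _)
    rw [this]; positivity
  · -- `A > 0`: optimise `λ = √B/√A`
    have hsA : 0 < Real.sqrt A := Real.sqrt_pos.2 hApos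
    have hl := key (Real.sqrt B / Real.sqrt A)
    have e1 : (Real.sqrt B / Real.sqrt A) ^ 2 * A = B := by
      rw [div_pow, Real.sq_sqrt hB0, Real.sq_sqrt hA0]; field_simp
    rw [e1] at hl
    -- `2 (√B/√A) X ≤ 2B` ⇒ `X ≤ √A √B`
    by_cases hB00 : B = 0
    · -- then `b = 0` a.e. and the integral vanishes
      have hbz : (fun x => b x ^ 2) =ᵐ[volume] 0 := (integral_eq_zero_iff_of_nonneg (fun x => sq_nonneg _) hb2).1 hB00
      have habz : (fun x => a x * b x) =ᵐ[volume] 0 := by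
        filter_upwards [hbz] with x hx
        have : b x = 0 := by simpa using hx
        simp [this]
      rw [integral_congr_ae habz]; simp only [Pi.zero_apply, integral_zero, abs_zero]; positivity
    · have hBpos : 0 < B := lt_of_le_of_ne hB0 (Ne.symm hB00)
      have hsB : 0 < Real.sqrt B := Real.sqrt_pos.2 hBpos
      have h2 : 2 * (Real.sqrt B / Real.sqrt A) * |∫ x, a x * b x| ≤ 2 * (Real.sqrt B * Real.sqrt B) := by
        rw [Real.mul_self_sqrt hB0]; linarith
      have h3 : Real.sqrt B / Real.sqrt A * |∫ x, a x * b x| ≤ Real.sqrt B * Real.sqrt B := by linarith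
      rw [div_mul_eq_mul_div, div_le_iff₀ hsA] at h3
      nlinarith [abs_nonneg (∫ x, a x * b x)]

/-! ### §1. H6d: the smoothed remainder is admissible -/

section Admissible

variable {s : ℝ} {r : ZM → ℝ} {M : ℝ}

/-- First partials of `P_s r` are bounded (sup-norm gradient estimate of the toolkit). [folklore] -/
theorem abs_pderiv_heatSmooth_le (hs : 0 < s) (hm : Measurable r) (hb : ∀ x, |r x| ≤ M) (p : Fin 3 × Fin 3) (x : ZM) :
    |pderiv p (heatSmooth s r) x| ≤ (2 : ℝ) ^ ((Module.finrank ℝ ZM : ℝ) / 2) * (s / 2) ^ (-(1 / 2 : ℝ)) * M := by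
  rw [heatSmooth_eq_heatExtension]
  refine (abs_pderiv_le_norm_fderiv _ p x).trans ?_
  exact Literature.Analysis.UnboundedOperators.norm_fderiv_heatExtension_le_of_bounded hm.aestronglyMeasurable
    (fun z => by rw [Real.norm_eq_abs]; exact hb z) (half_pos hs) x

/-- Second partials of `P_s r` are bounded: `P_s = e^{(s/4)Δ} e^{(s/4)Δ}`, the inner factor is `C¹` with bounded gradient,
so one derivative falls inside (`fderiv_heatExtension_apply_of_bounded`) and the outer one is again estimated by the
sup-norm gradient bound. [folklore] -/
theorem exists_bound_pderiv_pderiv_heatSmooth (hs : 0 < s) (hm : Measurable r) (hb : ∀ x, |r x| ≤ M) (hi : Integrable r) :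
    ∃ C : ℝ, ∀ p q x, |pderiv p (pderiv q (heatSmooth s r)) x| ≤ C := by
  have hs4 : 0 < s / 4 := by positivity
  have hmem : MemLp r 1 volume := memLp_one_iff_integrable.2 hi
  set w : ZM → ℝ := Literature.Analysis.UnboundedOperators.heatExtension r (s / 4) with hw
  have hwC : ContDiff ℝ 1 w :=
    (Literature.Analysis.UnboundedOperators.contDiff_heatExtension_holds hmem le_rfl hs4).of_le (by exact_mod_cast le_top)
  have hw0 : ∀ z, ‖w z‖ ≤ M := fun z =>
    Literature.Analysis.UnboundedOperators.norm_heatExtension_le (fun z => by rw [Real.norm_eq_abs]; exact hb z) hs4 z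
  set C₁ : ℝ := (2 : ℝ) ^ ((Module.finrank ℝ ZM : ℝ) / 2) * (s / 4) ^ (-(1 / 2 : ℝ)) * M with hC₁
  have hw1 : ∀ q z, ‖fderiv ℝ w z (unitDir q)‖ ≤ C₁ := fun q z => by
    have h := Literature.Analysis.UnboundedOperators.norm_fderiv_heatExtension_apply_le_of_bounded
      hm.aestronglyMeasurable (fun z => by rw [Real.norm_eq_abs]; exact hb z) hs4 z (unitDir q)
    rw [norm_unitDir, mul_one] at h
    exact h
  -- `P_s r = e^{(s/4)Δ} w`
  have hsemi : heatSmooth s r = Literature.Analysis.UnboundedOperators.heatExtension w (s / 4) := by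
    rw [heatSmooth_eq_heatExtension, hw, Literature.Analysis.UnboundedOperators.heatExtension_add_holds hmem le_rfl hs4 hs4]
    congr 1; ring
  -- the first partial is the heat extension of `∂_q w`
  have hfirst : ∀ q, pderiv q (heatSmooth s r) =
      fun x => Literature.Analysis.UnboundedOperators.heatExtension (fun z => fderiv ℝ w z (unitDir q)) (s / 4) x := by
    intro q; funext x
    rw [hsemi, pderiv]
    exact Literature.Analysis.UnboundedOperators.fderiv_heatExtension_apply_of_bounded hwC hw0 (hw1 q) hs4 x
  refine ⟨(2 : ℝ) ^ ((Module.finrank ℝ ZM : ℝ) / 2) * (s / 4) ^ (-(1 / 2 : ℝ)) * C₁, fun p q x => ?_⟩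
  rw [hfirst q]
  refine (abs_pderiv_le_norm_fderiv _ p x).trans ?_
  have hmeas : AEStronglyMeasurable (fun z => fderiv ℝ w z (unitDir q)) volume :=
    ((hwC.continuous_fderiv one_ne_zero).clm_apply continuous_const).aestronglyMeasurable
  exact Literature.Analysis.UnboundedOperators.norm_fderiv_heatExtension_le_of_bounded hmeas (hw1 q) hs4 x

/-- `∂_p (P_s r) ∈ L²` for `r ∈ L²` (Young). [folklore] -/
theorem integrable_pderiv_heatSmooth_sq (hs : 0 < s) (hr : MemLp r 2 volume) (p : Fin 3 × Fin 3) :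
    Integrable fun x => pderiv p (heatSmooth s r) x ^ 2 := by
  have h := Literature.Analysis.UnboundedOperators.memLp_fderiv_heatExtension_apply hr (by norm_num) (half_pos hs) (unitDir p)
  rw [heatSmooth_eq_heatExtension]
  exact h.integrable_sq

/-- **H6d — the smoothed remainder is admissible**: for a bounded measurable integrable colour-invariant `r` with
`(1 + ‖x‖⁴) r² ∈ L¹` and `0 < s`, `P_s r ∈ IsKacFn`. [folklore] -/
theorem isKacFn_heatSmooth (hs : 0 < s) (hm : Measurable r) (hb : ∀ x, |r x| ≤ M) (hi : Integrable r)
    (hinv : IsGaugeInv r) (hw : Integrable fun x => (1 + ‖x‖ ^ 4) * r x ^ 2) : IsKacFn (heatSmooth s r) := by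
  have hmem1 : MemLp r 1 volume := memLp_one_iff_integrable.2 hi
  have hmem2 : MemLp r 2 volume := memLp_two_of_bounded_integrable hm hb hi
  obtain ⟨C₂, hC₂⟩ := exists_bound_pderiv_pderiv_heatSmooth hs hm hb hi
  set C₁ : ℝ := (2 : ℝ) ^ ((Module.finrank ℝ ZM : ℝ) / 2) * (s / 2) ^ (-(1 / 2 : ℝ)) * M with hC₁
  have hM0 : 0 ≤ M := (abs_nonneg _).trans (hb 0)
  refine ⟨?_, isGaugeInv_heatSmooth s hinv, ⟨max M (max C₁ C₂), fun x => ⟨?_, fun p => ?_, fun p q => ?_⟩⟩,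
    integrable_heatSmooth hs hi, fun p => integrable_pderiv_heatSmooth_sq hs hmem2 p,
    (integral_potential_mul_heatSmooth_sq_le hs hm hb hi hw).1⟩
  · exact contDiff_heatSmooth hs hmem1 le_rfl 2
  · exact (abs_heatSmooth_le hs hb x).trans (le_max_left _ _)
  · exact (abs_pderiv_heatSmooth_le hs hm hb p x).trans ((le_max_left _ _).trans (le_max_right _ _))
  · exact (hC₂ p q x).trans ((le_max_right _ _).trans (le_max_right _ _))

end Admissible

/-! ### §2. H6b: the energy of the smoothed function is controlled by the jump form -/

section Energy

variable {t : ℝ} {r : ZM → ℝ} {M : ℝ}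

/-- **H6b — reverse Poincaré, integrated**: `½ ∫ ‖∇ P_{t/2} r‖² ≤ flatJump t r` for bounded measurable integrable `r`
(`P_{t/2} = e^{σΔ}e^{(t/4−σ)Δ}`; Bakry–Émery `(e^{σΔ}f)² + 2σ‖∇e^{σΔ}f‖² ≤ e^{σΔ}(f²)` pointwise; integrate; mass
preservation and contraction; let `σ ↑ t/4`; the mass defect `t·flatJump t r = ‖r‖² − ‖P_{t/2}r‖²`).
[cite: BakryGentilLedoux2014, Thm. 4.7.2] -/
theorem half_integral_norm_gradient_sq_heatSmooth_le_flatJump (ht : 0 < t) (hm : Measurable r) (hb : ∀ x, |r x| ≤ M)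
    (hi : Integrable r) :
    (1 / 2 : ℝ) * ∫ x, ‖gradient (heatSmooth (t / 2) r) x‖ ^ 2 ≤ flatJump t r := by
  have hmem1 : MemLp r 1 volume := memLp_one_iff_integrable.2 hi
  have hmem2 : MemLp r 2 volume := memLp_two_of_bounded_integrable hm hb hi
  have hM0 : 0 ≤ M := (abs_nonneg _).trans (hb 0)
  set τ : ℝ := t / 4 with hτ
  have hτ0 : 0 < τ := by positivity
  set u := heatSmooth (t / 2) r with hu
  have huE : u = Literature.Analysis.UnboundedOperators.heatExtension r τ := by
    rw [hu, heatSmooth_eq_heatExtension]; congr 1; rw [hτ]; ring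
  -- integrability of `‖∇u‖²` and `u²`
  have hG : Integrable fun x => ‖gradient u x‖ ^ 2 := by
    have h := integrable_finsetSum (Finset.univ) fun p _ => integrable_pderiv_heatSmooth_sq (half_pos ht) hmem2 p
    refine h.congr (Eventually.of_forall fun x => ?_)
    show ∑ i, pderiv i (heatSmooth (t / 2) r) x ^ 2 = ‖gradient u x‖ ^ 2
    rw [hu, norm_gradient_sq]
  have hu2 : Integrable fun x => u x ^ 2 := (memLp_two_heatSmooth (half_pos ht) hmem2).integrable_sq
  set G : ℝ := ∫ x, ‖gradient u x‖ ^ 2 with hGdef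
  have hG0 : 0 ≤ G := integral_nonneg fun x => sq_nonneg _
  -- the mass defect
  have hmass : t * flatJump t r = (∫ x, r x ^ 2) - ∫ x, u x ^ 2 := by
    rw [flatJump_eq_mass_defect ht hm hb hi, hu]; field_simp
  -- the reverse Poincaré inequality at every `σ < τ`
  have key : ∀ σ : ℝ, 0 < σ → σ < τ → 2 * σ * G ≤ t * flatJump t r := by
    intro σ hσ hστ
    have hδ : 0 < τ - σ := by linarith
    set f : ZM → ℝ := Literature.Analysis.UnboundedOperators.heatExtension r (τ - σ) with hf
    have hfc : Continuous f :=
      (Literature.Analysis.UnboundedOperators.contDiff_heatExtension_holds hmem1 le_rfl hδ).continuous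
    have hfb : ∀ z, ‖f z‖ ≤ M := fun z =>
      Literature.Analysis.UnboundedOperators.norm_heatExtension_le (fun z => by rw [Real.norm_eq_abs]; exact hb z) hδ z
    have hf2mem : MemLp f 2 volume := Literature.Analysis.UnboundedOperators.memLp_heatExtension_holds hmem2 (by norm_num) hδ
    have hf2 : Integrable fun z => f z ^ 2 := hf2mem.integrable_sq
    have hsemi : u = Literature.Analysis.UnboundedOperators.heatExtension f σ := by
      rw [huE, hf, Literature.Analysis.UnboundedOperators.heatExtension_add_holds hmem1 le_rfl hδ hσ]
      congr 1; ring
    -- pointwise Bakry–Émery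
    have hpt : ∀ x, u x ^ 2 + 2 * σ * ‖gradient u x‖ ^ 2 ≤
        Literature.Analysis.UnboundedOperators.heatExtension (fun y => f y ^ 2) σ x := fun x => by
      rw [norm_gradient_eq_norm_fderiv, hsemi]
      exact Literature.Analysis.UnboundedOperators.sq_heatExtension_add_le_heatExtension_sq hfc hfb hσ x
    have hPf2 : Integrable (Literature.Analysis.UnboundedOperators.heatExtension (fun y => f y ^ 2) σ) :=
      Literature.Analysis.UnboundedOperators.integrable_heatExtension hf2 hσ
    have hL : Integrable fun x => u x ^ 2 + 2 * σ * ‖gradient u x‖ ^ 2 := hu2.add (hG.const_mul _)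
    have hint := integral_mono hL hPf2 hpt
    rw [integral_add hu2 (hG.const_mul _), integral_const_mul,
      Literature.Analysis.UnboundedOperators.integral_heatExtension_eq hf2 hσ] at hint
    -- `∫ f² ≤ ∫ r²` (contraction): `f = heatSmooth (4(τ−σ)/2) r`
    have hcontr : ∫ z, f z ^ 2 ≤ ∫ z, r z ^ 2 := by
      have h := integral_sq_heatSmooth_le (by positivity : 0 < 4 * (τ - σ)) hm hb hi
      have e : heatSmooth (4 * (τ - σ) / 2) r = f := by
        rw [heatSmooth_eq_heatExtension, hf]; congr 1; ring
      rwa [e] at h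
    rw [hmass]
    linarith
  -- let `σ ↑ τ = t/4`
  have hτG : τ * G ≤ t / 2 * flatJump t r := by
    by_contra hcon
    push Not at hcon
    have hFJ : 0 ≤ flatJump t r := flatJump_nonneg ht r
    have hGpos : 0 < G := by
      rcases hG0.eq_or_lt with h | h
      · rw [← h, mul_zero] at hcon; nlinarith
      · exact h
    set K : ℝ := t / 2 * flatJump t r with hK
    have hK0 : 0 ≤ K := by positivity
    -- `σ := (τ + K/G)/2` lies in `(K/G, τ)`
    have hKG : K / G < τ := by rw [div_lt_iff₀ hGpos]; linarith
    set σ : ℝ := (τ + K / G) / 2 with hσdef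
    have hσpos : 0 < σ := by
      have : 0 ≤ K / G := div_nonneg hK0 hG0
      rw [hσdef]; linarith
    have hστ : σ < τ := by rw [hσdef]; linarith
    have h := key σ hσpos hστ
    have hσK : K / G < σ := by rw [hσdef]; linarith
    rw [div_lt_iff₀ hGpos] at hσK
    rw [hK] at hσK
    linarith
  rw [hτ] at hτG
  nlinarith [hτG, ht]

end Energy

/-! ### §3. H6e: the smoothed remainder stays almost orthogonal -/

section AlmostOrthogonal

/-- **H6e — almost orthogonality after smoothing**: if `r ⊥ f` in `L²` then
`|⟨P_s r, f⟩| ≤ ‖r‖₂ · √((s/2)∫‖Df‖²)` for `C¹` `f` with `f, Df` bounded and `f², ‖Df‖² ∈ L¹`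
(`⟨P_s r, f⟩ = ⟨r, P_s f − f⟩`, Cauchy–Schwarz, Ledoux's defect). [cite: Ledoux2003, §1] -/
theorem abs_integral_heatSmooth_mul_le {s : ℝ} (hs : 0 < s) {r : ZM → ℝ} (hm : Measurable r) {M : ℝ}
    (hb : ∀ x, |r x| ≤ M) (hi : Integrable r) {f : ZM → ℝ} (hf : ContDiff ℝ 1 f) {C₀ C₁ : ℝ}
    (h0 : ∀ z, ‖f z‖ ≤ C₀) (h1 : ∀ z, ‖fderiv ℝ f z‖ ≤ C₁) (hf2 : Integrable (fun z => f z ^ 2))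
    (hD2 : Integrable (fun z => ‖fderiv ℝ f z‖ ^ 2)) (horth : ∫ x, r x * f x = 0) :
    |∫ x, heatSmooth s r x * f x| ≤ Real.sqrt (∫ x, r x ^ 2) * Real.sqrt (s / 2 * ∫ z, ‖fderiv ℝ f z‖ ^ 2) := by
  have hr2 : MemLp r 2 volume := memLp_two_of_bounded_integrable hm hb hi
  have hfm : MemLp f 2 volume := (memLp_two_iff_integrable_sq hf.continuous.aestronglyMeasurable).2 hf2
  have hPf : MemLp (heatSmooth s f) 2 volume := memLp_two_heatSmooth hs hfm
  have hd : MemLp (fun x => heatSmooth s f x - f x) 2 volume := hPf.sub hfm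
  -- transposition and orthogonality
  have e1 : ∫ x, heatSmooth s r x * f x = ∫ x, r x * (heatSmooth s f x - f x) := by
    rw [integral_heatSmooth_mul_comm hs hr2 hfm]
    have I1 : Integrable fun x => r x * heatSmooth s f x := hr2.integrable_mul hPf
    have I2 : Integrable fun x => r x * f x := hr2.integrable_mul hfm
    have e : ∫ x, r x * (heatSmooth s f x - f x) = (∫ x, r x * heatSmooth s f x) - ∫ x, r x * f x := by
      rw [← integral_sub I1 I2]
      exact integral_congr_ae (Eventually.of_forall fun x => by ring)
    rw [e, horth, sub_zero]
  rw [e1]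
  refine (abs_integral_mul_le_sqrt_mul_sqrt hr2 hd).trans (mul_le_mul_of_nonneg_left ?_ (Real.sqrt_nonneg _))
  refine Real.sqrt_le_sqrt ?_
  have h := integral_sq_sub_heatSmooth_le hs hf h0 h1 hf2 hD2
  calc ∫ x, (heatSmooth s f x - f x) ^ 2 = ∫ x, (f x - heatSmooth s f x) ^ 2 :=
        integral_congr_ae (Eventually.of_forall fun x => by ring)
    _ ≤ s / 2 * ∫ x, ‖fderiv ℝ f x‖ ^ 2 := h

end AlmostOrthogonal

end Summit.QuantumFields.YangMills.Theorems.FemtoTransferGap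

end
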